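import Summits.AtomisticToContinuum.Crystallization.Theorems.PalmUnimodularRigidityMinimiserShellsEnergyFloor
import Summits.AtomisticToContinuum.Crystallization.Theorems.PalmUnimodularRigidityCruxesToPalmRigidity
import Summits.AtomisticToContinuum.Crystallization.Theorems.MinimiserShells.Negative.Rootedness

/-!
# Mecke pricing of a hybrid pointwise certificate (stub `stub_meckePricing` of line
# `octahedral-annulus-mandate`, crux `MinimiserShells`, stmt-AtomisticToContinuum-9225)

**Theorem** (`stub_meckePricing_unfolded`).  Let `P` be a point-stationary (`IsPointStationaryLaw`,
the Mecke / mass-transport identity) probability law on configurations of `ℝ³`, almost surely a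
rooted `δ`-hard-core counting measure, and let `t : (configuration, atom) → ℝ` be a jointly
measurable, bounded (`|t| ≤ M`), finite-range (`t μ y = 0` for `‖y‖ > R`) bond transfer with
divergence at the root `div t (μ) = ∫ (t μ y − t (θ_y μ) (−y)) dμ(y)`, `θ_y μ = μ.map (· − y)`.
If `e₀ ≤ h(μ) + div t(μ)` for EVERY rooted `δ`-hard-core `μ`, and `e₀ + c₀ ≤ h(μ) + div t(μ)`
whenever moreover `¬ G μ` (`c₀ ≥ 0`, `G` an arbitrary predicate), then
`e₀ + c₀ · P*(¬ G) ≤ E_P[h]` (`P*` = Mathlib's outer measure of the possibly non-measurable event).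

**Proof.**  Mecke applied to `ofReal ∘ t` and `ofReal ∘ (−t)` gives `E_P[sent±] = E_P[received±]`,
all four finite (at most `M (2⌈R⌉₊/δ+1)³`, packing bound of the truncated configuration kernel
`EnergyFloor.truncKernel`), so the measurable version
`F = h' + (sent⁺ − sent⁻) − (received⁺ − received⁻)` of `h + div t` (built from the s-finite
truncated kernel and `PalmUnimodularRigidity.measurable_map_sub_kernel`; equal to `h + div t` on
every hard-core configuration) has `E_P[F] = E_P[h'] = E_P[h]`.  With the MEASURABLE event
`B = {e₀ + c₀ ≤ F}`: almost surely `e₀ + c₀ 1_B ≤ F`, whence `e₀ + c₀ P(B) ≤ E_P[h]`; and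
`{¬ G} ⊆ B ∪ (P-null set)`, whence `P*(¬ G) ≤ P(B)`.
-/

noncomputable section

open MeasureTheory ProbabilityTheory
open scoped ENNReal BigOperators

namespace Summit.AtomisticToContinuum.Crystallization.Theorems.PalmUnimodularRigidityMinimiserShells.MeckePricing

open Literature.Probability.Process (IsPointStationaryLaw IsRootedHardCore)
open Literature.MathematicalPhysics.StatisticalMechanics (lennardJones rootEnergy)
open Summit.AtomisticToContinuum.Crystallization.Theorems.MinimiserShells.Negative.LoadBearing (eStar meanRootEnergy)
open Summit.AtomisticToContinuum.Crystallization.Theorems.MinimiserShells.Negative.Rootedness (E3)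
open Summit.AtomisticToContinuum.Crystallization.Theorems.PalmUnimodularRigidityMinimiserShells.EnergyFloor
  (trunc truncKernel truncKernel_apply trunc_of_mem trunc_closedBall_le packBound mem_hcClass_of_hc
    measurable_lintegral_trunc rootEnergy' measurable_rootEnergy' rootEnergy'_eq_of_hc
    rootEnergy'_bounds_of_hc integrable_of_lintegral_ofReal_ne_top)
open Summit.AtomisticToContinuum.Crystallization.Theorems.PalmUnimodularRigidity (measurable_map_sub_kernel)

/-! ## Bounded finite-range integrands -/

/-- A real function bounded by `M` in absolute value and vanishing outside the closed ball
`B̄(0, R)` has `∫⁻ ofReal f dν ≤ ofReal M · ν (B̄(0, R))`. -/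
theorem lintegral_ofReal_le_of_bdd {R M : ℝ} (ν : Measure E3) {f : E3 → ℝ}
    (hM : ∀ y, |f y| ≤ M) (hR : ∀ y, R < ‖y‖ → f y = 0) :
    ∫⁻ y, ENNReal.ofReal (f y) ∂ν ≤ ENNReal.ofReal M * ν (Metric.closedBall 0 R) := by
  calc ∫⁻ y, ENNReal.ofReal (f y) ∂ν
      ≤ ∫⁻ y, (Metric.closedBall (0 : E3) R).indicator (fun _ => ENNReal.ofReal M) y ∂ν := by
        refine lintegral_mono fun y => ?_
        by_cases hy : y ∈ Metric.closedBall (0 : E3) R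
        · rw [Set.indicator_of_mem hy]
          exact ENNReal.ofReal_le_ofReal ((le_abs_self _).trans (hM y))
        · rw [Set.indicator_of_notMem hy]
          rw [Metric.mem_closedBall, dist_zero_right, not_le] at hy
          rw [hR y hy, ENNReal.ofReal_zero]
    _ ≤ ENNReal.ofReal M * ν (Metric.closedBall 0 R) := lintegral_indicator_const_le _ _

/-- Over a TRUNCATED configuration (`EnergyFloor.trunc`, which obeys the packing bounds), such a
function has `∫⁻ ofReal f ≤ ofReal M · (2⌈R⌉₊/δ+1)³`, uniformly in the configuration. -/
theorem lintegral_trunc_ofReal_le {δ R M : ℝ} (μ : Measure E3) {f : E3 → ℝ}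
    (hM : ∀ y, |f y| ≤ M) (hR : ∀ y, R < ‖y‖ → f y = 0) :
    ∫⁻ y, ENNReal.ofReal (f y) ∂(trunc δ μ) ≤ ENNReal.ofReal M * packBound δ ⌈R⌉₊ := by
  refine (lintegral_ofReal_le_of_bdd (trunc δ μ) hM hR).trans (mul_le_mul' le_rfl ?_)
  exact (measure_mono (Metric.closedBall_subset_closedBall (Nat.le_ceil R))).trans
    (trunc_closedBall_le δ μ ⌈R⌉₊)

/-- The uniform bound `ofReal M · (2⌈R⌉₊/δ+1)³` is finite. -/
theorem bound_lt_top (δ R M : ℝ) : ENNReal.ofReal M * packBound δ ⌈R⌉₊ < ∞ :=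
  ENNReal.mul_lt_top ENNReal.ofReal_lt_top ENNReal.ofReal_lt_top

/-! ## The sent and received sums of a transfer: measurable versions and the Mecke identity -/

section Transfer

variable {δ R M : ℝ} {t : Measure E3 → E3 → ℝ}

/-- The negative `−t` of an admissible transfer is an admissible transfer. -/
theorem neg_transfer (ht : Measurable (Function.uncurry t)) (hM : ∀ μ y, |t μ y| ≤ M)
    (hR : ∀ μ y, R < ‖y‖ → t μ y = 0) :
    Measurable (Function.uncurry fun μ y => -t μ y) ∧ (∀ μ y, |(-t μ y)| ≤ M) ∧
      ∀ μ y, R < ‖y‖ → -t μ y = 0 :=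
  ⟨ht.neg, fun μ y => by rw [abs_neg]; exact hM μ y, fun μ y hy => by rw [hR μ y hy, neg_zero]⟩

/-- **Measurable sent sum**: `μ ↦ ∑_{y ∈ trunc μ} (t μ y)⁺` is Giry-measurable (s-finite truncated
configuration kernel). -/
theorem measurable_sent (ht : Measurable (Function.uncurry t)) :
    Measurable fun μ : Measure E3 => ∫⁻ y, ENNReal.ofReal (t μ y) ∂(trunc δ μ) :=
  (measurable_lintegral_trunc (δ := δ) (k := fun ν y => ENNReal.ofReal (t ν y))
    (ENNReal.measurable_ofReal.comp ht)).comp (measurable_id.prodMk measurable_id)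

/-- Joint measurability of the re-rooted integrand `(μ, y) ↦ (t (θ_y (trunc μ)) (−y))⁺`. -/
theorem measurable_rerooted (ht : Measurable (Function.uncurry t)) :
    Measurable fun p : Measure E3 × E3 =>
      ENNReal.ofReal (t ((truncKernel δ p.1).map (fun z => z - p.2)) (-p.2)) :=
  ENNReal.measurable_ofReal.comp
    (ht.comp ((measurable_map_sub_kernel (truncKernel δ)).prodMk measurable_snd.neg))

/-- **Measurable received sum**: `μ ↦ ∑_{y ∈ trunc μ} (t (θ_y (trunc μ)) (−y))⁺` is
Giry-measurable. -/
theorem measurable_received (ht : Measurable (Function.uncurry t)) :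
    Measurable fun μ : Measure E3 =>
      ∫⁻ y, ENNReal.ofReal (t ((trunc δ μ).map (fun z => z - y)) (-y)) ∂(trunc δ μ) := by
  have h := Measurable.lintegral_kernel_prod_right (κ := truncKernel δ)
    (f := fun μ y => ENNReal.ofReal (t ((truncKernel δ μ).map (fun z => z - y)) (-y)))
    (measurable_rerooted ht)
  simpa only [truncKernel_apply] using h

/-- For a fixed configuration, the re-rooted integrand `y ↦ t (θ_y μ) (−y)` is measurable on every
rooted hard-core `μ`. -/
theorem measurable_rerooted_left (hδ : 0 < δ) (ht : Measurable (Function.uncurry t))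
    {μ : Measure E3} (hμ : IsRootedHardCore δ μ) :
    Measurable fun y : E3 => t (Measure.map (fun z => z - y) μ) (-y) := by
  have h : Measurable fun y : E3 =>
      t ((truncKernel δ ((μ, y) : Measure E3 × E3).1).map (fun z => z - ((μ, y) : Measure E3 × E3).2))
        (-((μ, y) : Measure E3 × E3).2) :=
    (ht.comp ((measurable_map_sub_kernel (truncKernel δ)).prodMk measurable_snd.neg)).comp
      measurable_prodMk_left
  simpa only [truncKernel_apply, trunc_of_mem (mem_hcClass_of_hc hδ hμ)] using h

/-- The sent sum is at most `ofReal M · (2⌈R⌉₊/δ+1)³`, for every configuration. -/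
theorem sent_le (hM : ∀ μ y, |t μ y| ≤ M) (hR : ∀ μ y, R < ‖y‖ → t μ y = 0) (μ : Measure E3) :
    ∫⁻ y, ENNReal.ofReal (t μ y) ∂(trunc δ μ) ≤ ENNReal.ofReal M * packBound δ ⌈R⌉₊ :=
  lintegral_trunc_ofReal_le μ (hM μ) (hR μ)

/-- The received sum is at most `ofReal M · (2⌈R⌉₊/δ+1)³`, for every configuration. -/
theorem received_le (hM : ∀ μ y, |t μ y| ≤ M) (hR : ∀ μ y, R < ‖y‖ → t μ y = 0)
    (μ ν : Measure E3) :
    ∫⁻ y, ENNReal.ofReal (t (ν.map (fun z => z - y)) (-y)) ∂(trunc δ μ) ≤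
      ENNReal.ofReal M * packBound δ ⌈R⌉₊ :=
  lintegral_trunc_ofReal_le μ (fun y => hM _ _) (fun y hy => hR _ _ (by rwa [norm_neg]))

/-- **Mecke for the transfer**: `E_P[sent⁺] = E_P[received⁺]` (in `ℝ≥0∞`, through the truncated
configuration, which is the configuration itself almost surely). -/
theorem lintegral_sent_eq_received (hδ : 0 < δ) {P : Measure (Measure E3)}
    (hcore : ∀ᵐ μ ∂P, IsRootedHardCore δ μ) (hstat : IsPointStationaryLaw P)
    (ht : Measurable (Function.uncurry t)) :
    ∫⁻ μ, (∫⁻ y, ENNReal.ofReal (t μ y) ∂(trunc δ μ)) ∂P =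
      ∫⁻ μ, (∫⁻ y, ENNReal.ofReal (t ((trunc δ μ).map (fun z => z - y)) (-y)) ∂(trunc δ μ)) ∂P := by
  have hMecke := hstat (fun μ y => ENNReal.ofReal (t μ y)) (ENNReal.measurable_ofReal.comp ht)
  have hae : ∀ᵐ μ ∂P, trunc δ μ = μ :=
    hcore.mono fun μ hμ => trunc_of_mem (mem_hcClass_of_hc hδ hμ)
  calc ∫⁻ μ, (∫⁻ y, ENNReal.ofReal (t μ y) ∂(trunc δ μ)) ∂P
      = ∫⁻ μ, (∫⁻ y, ENNReal.ofReal (t μ y) ∂μ) ∂P :=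
        lintegral_congr_ae (hae.mono fun μ hμ => by dsimp only; rw [hμ])
    _ = ∫⁻ μ, (∫⁻ y, ENNReal.ofReal (t (μ.map (fun z => z - y)) (-y)) ∂μ) ∂P := hMecke
    _ = ∫⁻ μ, (∫⁻ y, ENNReal.ofReal (t ((trunc δ μ).map (fun z => z - y)) (-y)) ∂(trunc δ μ)) ∂P :=
        lintegral_congr_ae (hae.mono fun μ hμ => by dsimp only; rw [hμ])

/-- **The transfer package**: the real-valued sent and received sums `μ ↦ (sent⁺ μ).toReal`,
`μ ↦ (received⁺ μ).toReal` are measurable, `P`-integrable, and have the same `P`-mean. -/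
theorem transfer_package (hδ : 0 < δ) (P : Measure (Measure E3)) [IsProbabilityMeasure P]
    (hcore : ∀ᵐ μ ∂P, IsRootedHardCore δ μ) (hstat : IsPointStationaryLaw P)
    (ht : Measurable (Function.uncurry t)) (hM : ∀ μ y, |t μ y| ≤ M)
    (hR : ∀ μ y, R < ‖y‖ → t μ y = 0) :
    Integrable (fun μ : Measure E3 => (∫⁻ y, ENNReal.ofReal (t μ y) ∂(trunc δ μ)).toReal) P ∧
    Integrable (fun μ : Measure E3 =>
      (∫⁻ y, ENNReal.ofReal (t ((trunc δ μ).map (fun z => z - y)) (-y)) ∂(trunc δ μ)).toReal) P ∧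
    ∫ μ, (∫⁻ y, ENNReal.ofReal (t μ y) ∂(trunc δ μ)).toReal ∂P =
      ∫ μ, (∫⁻ y, ENNReal.ofReal (t ((trunc δ μ).map (fun z => z - y)) (-y)) ∂(trunc δ μ)).toReal ∂P := by
  have hK := bound_lt_top δ R M
  set K : ℝ≥0∞ := ENNReal.ofReal M * packBound δ ⌈R⌉₊ with hKdef
  have hSm := measurable_sent (δ := δ) ht
  have hRm := measurable_received (δ := δ) ht
  have hSle : ∀ μ : Measure E3, ∫⁻ y, ENNReal.ofReal (t μ y) ∂(trunc δ μ) ≤ K :=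
    fun μ => sent_le hM hR μ
  have hRle : ∀ μ : Measure E3,
      ∫⁻ y, ENNReal.ofReal (t ((trunc δ μ).map (fun z => z - y)) (-y)) ∂(trunc δ μ) ≤ K :=
    fun μ => received_le hM hR μ (trunc δ μ)
  refine ⟨?_, ?_, ?_⟩
  · refine Integrable.of_bound hSm.ennreal_toReal.aestronglyMeasurable K.toReal
      (Filter.Eventually.of_forall fun μ => ?_)
    rw [Real.norm_eq_abs, abs_of_nonneg ENNReal.toReal_nonneg]
    exact ENNReal.toReal_mono hK.ne (hSle μ)
  · refine Integrable.of_bound hRm.ennreal_toReal.aestronglyMeasurable K.toReal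
      (Filter.Eventually.of_forall fun μ => ?_)
    rw [Real.norm_eq_abs, abs_of_nonneg ENNReal.toReal_nonneg]
    exact ENNReal.toReal_mono hK.ne (hRle μ)
  · rw [integral_toReal hSm.aemeasurable (Filter.Eventually.of_forall fun μ => (hSle μ).trans_lt hK),
      integral_toReal hRm.aemeasurable (Filter.Eventually.of_forall fun μ => (hRle μ).trans_lt hK),
      lintegral_sent_eq_received hδ hcore hstat ht]

/-- **The divergence through the four sums** on a rooted hard-core configuration:
`div t (μ) = (sent⁺ − sent⁻) − (received⁺ − received⁻)` (all `toReal`s of finite sums). -/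
theorem div_eq_of_hc (hδ : 0 < δ) (ht : Measurable (Function.uncurry t)) (hM : ∀ μ y, |t μ y| ≤ M)
    (hR : ∀ μ y, R < ‖y‖ → t μ y = 0) {μ : Measure E3} (hμ : IsRootedHardCore δ μ) :
    ∫ y, (t μ y - t (Measure.map (fun z => z - y) μ) (-y)) ∂μ =
      ((∫⁻ y, ENNReal.ofReal (t μ y) ∂(trunc δ μ)).toReal -
          (∫⁻ y, ENNReal.ofReal (-t μ y) ∂(trunc δ μ)).toReal) -
        ((∫⁻ y, ENNReal.ofReal (t ((trunc δ μ).map (fun z => z - y)) (-y)) ∂(trunc δ μ)).toReal -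
          (∫⁻ y, ENNReal.ofReal (-t ((trunc δ μ).map (fun z => z - y)) (-y)) ∂(trunc δ μ)).toReal) := by
  have htr : trunc δ μ = μ := trunc_of_mem (mem_hcClass_of_hc hδ hμ)
  have hfin : ∀ f : E3 → ℝ, (∀ y, |f y| ≤ M) → (∀ y, R < ‖y‖ → f y = 0) →
      ∫⁻ y, ENNReal.ofReal (f y) ∂μ ≠ ∞ := fun f hM' hR' => by
    have h := lintegral_trunc_ofReal_le (δ := δ) μ hM' hR'
    rw [htr] at h
    exact (h.trans_lt (bound_lt_top δ R M)).ne
  have ha : Measurable fun y => t μ y := ht.comp measurable_prodMk_left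
  have hb : Measurable fun y : E3 => t (Measure.map (fun z => z - y) μ) (-y) :=
    measurable_rerooted_left hδ ht hμ
  have hia : Integrable (fun y => t μ y) μ :=
    integrable_of_lintegral_ofReal_ne_top ha (hfin (fun y => t μ y) (hM μ) (hR μ))
      (hfin (fun y => -t μ y) (fun y => by rw [abs_neg]; exact hM μ y)
        (fun y hy => by rw [hR μ y hy, neg_zero]))
  have hib : Integrable (fun y : E3 => t (Measure.map (fun z => z - y) μ) (-y)) μ :=
    integrable_of_lintegral_ofReal_ne_top hb
      (hfin (fun y => t (Measure.map (fun z => z - y) μ) (-y)) (fun y => hM _ _)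
        (fun y hy => hR _ _ (by rwa [norm_neg])))
      (hfin (fun y => -t (Measure.map (fun z => z - y) μ) (-y))
        (fun y => by rw [abs_neg]; exact hM _ _)
        (fun y hy => by rw [hR _ _ (by rwa [norm_neg]), neg_zero]))
  rw [integral_sub hia hib, integral_eq_lintegral_pos_part_sub_lintegral_neg_part hia,
    integral_eq_lintegral_pos_part_sub_lintegral_neg_part hib, htr]

end Transfer

/-! ## The measurable version of `h + div t` and the pricing -/

/-- **Measurable version of `h + div t` with the right mean.**  For a point-stationary
`δ`-hard-core probability law `P` and an admissible transfer `t` there is a measurable,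
`P`-integrable `F` with `E_P[F] = E_P[h]` (`meanRootEnergy`; the divergence has mean zero by Mecke)
and `F μ = h(μ) + div t(μ)` for `P`-a.e. `μ`. -/
theorem exists_measurable_version {δ R M : ℝ} (hδ : 0 < δ) (P : Measure (Measure E3))
    [IsProbabilityMeasure P] (hcore : ∀ᵐ μ ∂P, IsRootedHardCore δ μ) (hstat : IsPointStationaryLaw P)
    {t : Measure E3 → E3 → ℝ} (ht : Measurable (Function.uncurry t)) (hM : ∀ μ y, |t μ y| ≤ M)
    (hR : ∀ μ y, R < ‖y‖ → t μ y = 0) :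
    ∃ F : Measure E3 → ℝ, Measurable F ∧ Integrable F P ∧ ∫ μ, F μ ∂P = meanRootEnergy P ∧
      ∀ᵐ μ ∂P, F μ = rootEnergy lennardJones μ +
        ∫ y, (t μ y - t (Measure.map (fun z => z - y) μ) (-y)) ∂μ := by
  obtain ⟨hnt, hnM, hnR⟩ := neg_transfer ht hM hR
  obtain ⟨hSp, hRp, hEp⟩ := transfer_package hδ P hcore hstat ht hM hR
  obtain ⟨hSn, hRn, hEn⟩ := transfer_package hδ P hcore hstat hnt hnM hnR
  -- the measurable root energy is integrable with mean `meanRootEnergy P`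
  have hbounds : ∀ᵐ μ ∂P, -(250 / 12 * δ⁻¹ ^ 6) ≤ rootEnergy' μ ∧ rootEnergy' μ ≤ 250 / 24 * δ⁻¹ ^ 12 :=
    hcore.mono fun μ hμ => rootEnergy'_bounds_of_hc hδ hμ
  have hint' : Integrable rootEnergy' P := by
    refine Integrable.of_bound measurable_rootEnergy'.aestronglyMeasurable
      (250 / 12 * δ⁻¹ ^ 6 + 250 / 24 * δ⁻¹ ^ 12) (hbounds.mono fun μ hμ => ?_)
    have h6 : (0 : ℝ) ≤ 250 / 12 * δ⁻¹ ^ 6 := by positivity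
    have h12 : (0 : ℝ) ≤ 250 / 24 * δ⁻¹ ^ 12 := by positivity
    rw [Real.norm_eq_abs, abs_le]
    constructor <;> linarith [hμ.1, hμ.2]
  have hmean : ∫ μ, rootEnergy' μ ∂P = meanRootEnergy P := by
    unfold meanRootEnergy
    exact integral_congr_ae (hcore.mono fun μ hμ => rootEnergy'_eq_of_hc hδ hμ)
  -- the measurable version
  refine ⟨fun μ => rootEnergy' μ +
      (((∫⁻ y, ENNReal.ofReal (t μ y) ∂(trunc δ μ)).toReal -
          (∫⁻ y, ENNReal.ofReal (-t μ y) ∂(trunc δ μ)).toReal) -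
        ((∫⁻ y, ENNReal.ofReal (t ((trunc δ μ).map (fun z => z - y)) (-y)) ∂(trunc δ μ)).toReal -
          (∫⁻ y, ENNReal.ofReal (-t ((trunc δ μ).map (fun z => z - y)) (-y)) ∂(trunc δ μ)).toReal)),
    ?_, ?_, ?_, ?_⟩
  · exact measurable_rootEnergy'.add
      (((measurable_sent ht).ennreal_toReal.sub (measurable_sent hnt).ennreal_toReal).sub
        ((measurable_received ht).ennreal_toReal.sub (measurable_received hnt).ennreal_toReal))
  · exact hint'.fun_add ((hSp.sub' hSn).sub' (hRp.sub' hRn))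
  · rw [integral_add hint' ((hSp.sub' hSn).sub' (hRp.sub' hRn)), integral_sub (hSp.sub' hSn) (hRp.sub' hRn),
      integral_sub hSp hSn, integral_sub hRp hRn, hEp, hEn, hmean]
    ring
  · refine hcore.mono fun μ hμ => ?_
    dsimp only
    rw [div_eq_of_hc hδ ht hM hR hμ, Literature.MathematicalPhysics.StatisticalMechanics.rootEnergy_def,
      rootEnergy'_eq_of_hc hδ hμ]

/-- **stub_meckePricing (unfolded form)**: Mecke pricing of a hybrid pointwise certificate.  If
`e₀ ≤ h + div t` at every rooted `δ`-hard-core configuration and `e₀ + c₀ ≤ h + div t` off the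
event `G` (`c₀ ≥ 0`; `t` a jointly measurable, bounded, finite-range transfer; `div t` = mass sent
minus mass received by the root), then `e₀ + c₀ · P{¬ G} ≤ E_P[h]` for every point-stationary
`δ`-hard-core probability law `P` (outer measure of `{¬ G}`; Mecke kills `E_P[div t]`). -/
theorem stub_meckePricing_unfolded : ∀ δ : ℝ, 0 < δ → ∀ P : Measure (Measure E3), IsProbabilityMeasure P → (∀ᵐ μ ∂P, IsRootedHardCore δ μ) → IsPointStationaryLaw P → ∀ R M : ℝ, ∀ t : Measure E3 → E3 → ℝ, (Measurable (Function.uncurry t) ∧ (∀ μ y, |t μ y| ≤ M) ∧ ∀ μ y, R < ‖y‖ → t μ y = 0) → ∀ G : Measure E3 → Prop, ∀ e₀ c₀ : ℝ, 0 ≤ c₀ → (∀ μ : Measure E3, IsRootedHardCore δ μ → e₀ ≤ rootEnergy lennardJones μ + ∫ y, (t μ y - t (Measure.map (fun z => z - y) μ) (-y)) ∂μ ∧ (¬ G μ → e₀ + c₀ ≤ rootEnergy lennardJones μ + ∫ y, (t μ y - t (Measure.map (fun z => z - y) μ) (-y)) ∂μ)) → e₀ + c₀ * (P {μ | ¬ G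 μ}).toReal ≤ meanRootEnergy P := by
  intro δ hδ P hP hcore hstat R M t htMR G e₀ c₀ hc₀ hcert
  obtain ⟨ht, hM, hR⟩ := htMR
  obtain ⟨F, hFm, hFi, hFint, hFae⟩ := exists_measurable_version hδ P hcore hstat ht hM hR
  -- the measurable pricing event
  set B : Set (Measure E3) := {μ | e₀ + c₀ ≤ F μ} with hB
  have hBm : MeasurableSet B := measurableSet_le measurable_const hFm
  -- almost surely `e₀ + c₀ 1_B ≤ F`
  have hpt : ∀ᵐ μ ∂P, e₀ + B.indicator (fun _ => c₀) μ ≤ F μ := by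
    filter_upwards [hcore, hFae] with μ hμ hF
    by_cases hb : μ ∈ B
    · rw [Set.indicator_of_mem hb]
      exact hb
    · rw [Set.indicator_of_notMem hb, add_zero, hF]
      exact (hcert μ hμ).1
  -- the outer measure of `{¬ G}` is at most `P B`
  have hGB : P {μ | ¬ G μ} ≤ P B := by
    have hsub : {μ | ¬ G μ} ⊆ B ∪ {μ | ¬ (IsRootedHardCore δ μ ∧ F μ = rootEnergy lennardJones μ +
        ∫ y, (t μ y - t (Measure.map (fun z => z - y) μ) (-y)) ∂μ)} := by
      intro μ hG
      by_cases hgood : IsRootedHardCore δ μ ∧ F μ = rootEnergy lennardJones μ +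
          ∫ y, (t μ y - t (Measure.map (fun z => z - y) μ) (-y)) ∂μ
      · left
        show e₀ + c₀ ≤ F μ
        rw [hgood.2]
        exact (hcert μ hgood.1).2 hG
      · exact Or.inr hgood
    have hnull : P {μ | ¬ (IsRootedHardCore δ μ ∧ F μ = rootEnergy lennardJones μ +
        ∫ y, (t μ y - t (Measure.map (fun z => z - y) μ) (-y)) ∂μ)} = 0 :=
      ae_iff.1 (hcore.and hFae)
    calc P {μ | ¬ G μ} ≤ P (B ∪ _) := measure_mono hsub
      _ ≤ P B + P _ := measure_union_le _ _
      _ = P B := by rw [hnull, add_zero]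
  -- integrate
  have hind : Integrable (B.indicator fun _ => c₀) P := (integrable_const c₀).indicator hBm
  have hle := integral_mono_ae ((integrable_const e₀).fun_add hind) hFi hpt
  rw [integral_add (integrable_const e₀) hind, integral_const, probReal_univ, one_smul,
    integral_indicator_const c₀ hBm, smul_eq_mul, measureReal_def, hFint] at hle
  calc e₀ + c₀ * (P {μ | ¬ G μ}).toReal ≤ e₀ + (P B).toReal * c₀ := by
        rw [mul_comm _ c₀]
        exact add_le_add le_rfl
          (mul_le_mul_of_nonneg_left (ENNReal.toReal_mono (measure_ne_top P B) hGB) hc₀)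
    _ ≤ meanRootEnergy P := hle

end Summit.AtomisticToContinuum.Crystallization.Theorems.PalmUnimodularRigidityMinimiserShells.MeckePricing

end
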